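import Mathlib
import HarnessLib
import Literature.MathematicalPhysics.KineticTheory.LangevinChainGibbs
import Summits.AtomisticToContinuum.FouriersLaw.Theorems.JunctionLocalityInsertionCutoff
import Summits.AtomisticToContinuum.FouriersLaw.Theorems.JunctionLocalityInsertionIBP

/-!
# Insertion identity toolbox, IV: the energy estimate

Support file for stub `stub_insertionIdentity` (line `thermalise-then-cut-probe-insertion`, crux
`stmt-AtomisticToContinuum-11748`). For the pinned chain at `T > 0`, thermostat weights `c ≥ 0` and
`g ∈ C²` with `g, 𝓛g ∈ L²(μ_T)` (`𝓛 = X_H + ∑ c_i S_i`): `∂_{p_i} g ∈ L²(μ_T)` on every site with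
`c_i > 0` — the cut-off Γ-identity `T ∑ c_i ∫(∂_i g)² χ_n² = −∫ 𝓛g · gχ_n² − 2T∑c_i∫ ∂_ig g χ_n∂_iχ_n`
(the transport term drops out because `X_H χ_n = 0`), then `n → ∞` by Fatou. This is exactly the
regularity of the forward fields `gb = (−L_dev)⁻¹(p_s² − T)` that the frames of the line do not
state. All [folklore]. No definitions.

WHY A SECOND PROOF (review of p84328). The same estimate exists in the tree as `Kubo.memLp_partialP`
(`JunctionLocalitySuperadditiveResistanceKuboDirichlet.lean`, for `σ X_H g + c S_B g = −k`), and
`pinnedChain_integrable_mul_gibbsDensity_iff` below has the statement of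
`Kubo.integrable_mul_gibbsDensity_iff` there. That file cannot be imported here: its import closure
contains `JunctionLocalitySuperadditiveResistanceThermoIBP.lean`, which DECLARES `thermo` and
`junctionOU` inside the namespace of the line's skeleton
(`…Cruxes.SuperadditiveResistance.ThermaliseThenCutProbeInsertion`), while the stub file this toolbox
serves must restate the skeleton's vocabulary verbatim in that very namespace — importing both gives
duplicate declarations. Hence this import-clean (definition-free, notation-only) toolbox re-derives
the estimate for its own weighted generator; the ~200 lines are the price of staying importable next
to the registered skeleton.
-/

noncomputable section

open scoped ContDiff Topology ENNReal NNReal Convolution Pointwise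
open MeasureTheory ProbabilityTheory Filter Set Function
open Literature.MathematicalPhysics.KineticTheory.HeatConduction

namespace Summit.AtomisticToContinuum.FouriersLaw.Cruxes.SuperadditiveResistance.InsertionToolbox

local notation "uP" i' => ((0, Pi.single i' 1) : PhaseSpace _)
local notation "uQ" i' => ((Pi.single i' 1, 0) : PhaseSpace _)

local notation "OU⟦" T' ";" i' ";" f' ";" x' "⟧" =>
  T' * partialP i' (partialP i' f') x' - Prod.snd (x' : PhaseSpace _) i' * partialP i' f' x'
local notation "XH⟦" P' ";" f' ";" x' "⟧" =>
  ∑ i, (Prod.snd (x' : PhaseSpace _) i * partialQ i f' x' -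
    partialQ i (OscillatorChain.hamiltonian P' _) x' * partialP i f' x')
local notation "GEN⟦" P' ";" T' ";" c' ";" f' ";" x' "⟧" =>
  XH⟦P' ; f' ; x'⟧ + ∑ i, c' i * OU⟦T' ; i ; f' ; x'⟧
local notation "CUT⟦" ω₂' ";" lam' ";" β' ";" γ' ";" n' ";" x' "⟧" =>
  Real.smoothTransition (2 - OscillatorChain.hamiltonian (pinnedChain ω₂' lam' β' γ') _ x' / ((n' : ℝ) + 1))

variable {L : ℕ}

/-! ### The energy estimate: `∂_{p_i} g ∈ L²(μ_T)` on the thermostatted sites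

For `g ∈ C² ∩ L²(μ_T)` with `𝓛g ∈ L²(μ_T)` (`𝓛` the weighted generator, weights `c ≥ 0`):
`T ∑ c_i ‖∂_{p_i} g‖² ≤ 2‖𝓛g‖‖g‖ + (cutoff error)`, by the Γ-calculus with energy cutoffs.
-/

section Energy

variable {ω₂ lam β : ℝ}

/-- The Liouville operator kills the square of the energy cutoff. [folklore] -/
theorem liouville_cutoff_sq (ω₂ lam β γ : ℝ) (L : ℕ) (n : ℕ) (x : PhaseSpace L) :
    XH⟦pinnedChain ω₂ lam β γ ; fun y : PhaseSpace L => CUT⟦ω₂ ; lam ; β ; γ ; n ; y⟧ ^ 2 ; x⟧ = 0 := by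
  have hχd : Differentiable ℝ fun y : PhaseSpace L => CUT⟦ω₂ ; lam ; β ; γ ; n ; y⟧ :=
    (contDiff_cutoff ω₂ lam β γ L n).differentiable (by simp)
  rw [liouville_comp (pinnedChain ω₂ lam β γ) (φ := fun t : ℝ => t ^ 2) (differentiable_pow 2) hχd,
    liouville_cutoff, mul_zero]

/-- `∫ (X_H g) g χ_n² ρ = 0` for `g ∈ C²`: the transport term drops out of the energy identity.
[folklore] -/
theorem integral_liouville_mul_self_cutoff_sq (ω₂ lam β γ : ℝ) (L : ℕ) (T : ℝ) (n : ℕ)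
    (hω : 0 < ω₂) (hl : 0 ≤ lam) (hβ : 0 ≤ β) {g : PhaseSpace L → ℝ} (hg : ContDiff ℝ 2 g) :
    ∫ x : PhaseSpace L, XH⟦pinnedChain ω₂ lam β γ ; g ; x⟧ *
      (g x * CUT⟦ω₂ ; lam ; β ; γ ; n ; x⟧ ^ 2) * (pinnedChain ω₂ lam β γ).gibbsDensity L T x = 0 := by
  have hU := pinnedChain_contDiff_U ω₂ lam β γ (n := 1)
  have hV := pinnedChain_contDiff_V ω₂ lam β γ (n := 1)
  have hgd : Differentiable ℝ g := hg.differentiable two_ne_zero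
  have hg1 : ContDiff ℝ 1 g := hg.of_le (by norm_num)
  have hχ : ContDiff ℝ 1 fun y : PhaseSpace L => CUT⟦ω₂ ; lam ; β ; γ ; n ; y⟧ ^ 2 :=
    (contDiff_cutoff_nat ω₂ lam β γ L n 1).pow 2
  have hχc : HasCompactSupport fun y : PhaseSpace L => CUT⟦ω₂ ; lam ; β ; γ ; n ; y⟧ ^ 2 :=
    (hasCompactSupport_cutoff hω hl hβ γ L n).comp_left (g := fun t : ℝ => t ^ 2) (by simp)
  -- `(X_H g) g = X_H (g²) / 2`
  have hpt : ∀ x : PhaseSpace L, XH⟦pinnedChain ω₂ lam β γ ; g ; x⟧ * (g x * CUT⟦ω₂ ; lam ; β ; γ ; n ; x⟧ ^ 2) =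
      (1 / 2) * (XH⟦pinnedChain ω₂ lam β γ ; fun y => g y * g y ; x⟧ * CUT⟦ω₂ ; lam ; β ; γ ; n ; x⟧ ^ 2) := by
    intro x
    rw [liouville_mul (pinnedChain ω₂ lam β γ) hgd hgd]
    ring
  simp_rw [hpt, mul_assoc]
  rw [integral_const_mul]
  simp_rw [← mul_assoc]
  rw [integral_liouville_mul_eq hU hV L T (hg1.mul hg1) hχ hχc]
  have h0 : ∀ x : PhaseSpace L,
      XH⟦pinnedChain ω₂ lam β γ ; fun y : PhaseSpace L => CUT⟦ω₂ ; lam ; β ; γ ; n ; y⟧ ^ 2 ; x⟧ = 0 :=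
    liouville_cutoff_sq ω₂ lam β γ L n
  simp only [h0, mul_zero, zero_mul, integral_zero, neg_zero]

/-- Conversion: `μ_T`-integrability is Lebesgue integrability against the weight `ρ` (same statement as
`Kubo.integrable_mul_gibbsDensity_iff` of `…KuboDirichlet.lean`, which cannot be imported here: see the
file header). [folklore] -/
theorem pinnedChain_integrable_mul_gibbsDensity_iff (hω : 0 < ω₂) (hl : 0 ≤ lam) (hβ : 0 ≤ β)
    (γ : ℝ) (L : ℕ) {T : ℝ} (hT : 0 < T) (f : PhaseSpace L → ℝ) :
    Integrable (fun x => f x * (pinnedChain ω₂ lam β γ).gibbsDensity L T x) ↔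
      Integrable f ((pinnedChain ω₂ lam β γ).gibbsMeasure L T) := by
  rw [OscillatorChain.gibbsMeasure_eq, integrable_tilted_iff (pinnedChain_integrable_gibbsDensity hω hl hβ γ L hT)]
  refine ⟨fun h => h.congr (ae_of_all _ fun x => ?_), fun h => h.congr (ae_of_all _ fun x => ?_)⟩
  · simp only [smul_eq_mul, OscillatorChain.exp_neg_hamiltonian_div]; ring
  · simp only [smul_eq_mul, OscillatorChain.exp_neg_hamiltonian_div]; ring

set_option hygiene false in
local notation "Pch" => pinnedChain ω₂ lam β γ
set_option hygiene false in
local notation "ρ♭" => OscillatorChain.gibbsDensity (pinnedChain ω₂ lam β γ) L T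
set_option hygiene false in
local notation "χ♭" => fun y : PhaseSpace L => CUT⟦ω₂ ; lam ; β ; γ ; n ; y⟧
set_option hygiene false in
local notation:max "χ♮" x':max => CUT⟦ω₂ ; lam ; β ; γ ; n ; x'⟧

/-- **The cut-off energy inequality.** For `g ∈ C²`, weights `c ≥ 0`, `T > 0` and the energy
cutoff `χ_n` (with `|∂_{p_i}χ_n| ≤ C`):
`(T/2) ∑ c_i ∫ (∂_i g)² χ_n² ρ ≤ ∫ |𝓛g · g| ρ + 2TC²(∑c_i) ∫ g² ρ`. [folklore] -/
theorem pinnedChain_energy_cutoff_le (hω : 0 < ω₂) (hl : 0 ≤ lam) (hβ : 0 ≤ β) (γ : ℝ)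
    (L : ℕ) {T : ℝ} (hT : 0 < T) {c : Fin L → ℝ} (hc : ∀ i, 0 ≤ c i) {g : PhaseSpace L → ℝ}
    (hg : ContDiff ℝ 2 g) (n : ℕ) {C : ℝ}
    (hC : ∀ (i : Fin L) (x : PhaseSpace L), |partialP i χ♭ x| ≤ C)
    (hI1 : Integrable fun x : PhaseSpace L => |GEN⟦Pch ; T ; c ; g ; x⟧ * g x| * ρ♭ x)
    (hI2 : Integrable fun x : PhaseSpace L => g x ^ 2 * ρ♭ x) :
    T / 2 * ∑ i, c i * ∫ x, partialP i g x ^ 2 * χ♮ x ^ 2 * ρ♭ x ≤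
      (∫ x, |GEN⟦Pch ; T ; c ; g ; x⟧ * g x| * ρ♭ x) +
        2 * T * C ^ 2 * (∑ i, c i) * ∫ x, g x ^ 2 * ρ♭ x := by
  have hU : ContDiff ℝ 1 (Pch).U := pinnedChain_contDiff_U ω₂ lam β γ
  have hV : ContDiff ℝ 1 (Pch).V := pinnedChain_contDiff_V ω₂ lam β γ
  have hρc : Continuous ρ♭ := pinnedChain_continuous_gibbsDensity ω₂ lam β γ L T
  have hρ0 : ∀ x, 0 < ρ♭ x := fun x => (Pch).gibbsDensity_pos L T x
  have hgd : Differentiable ℝ g := hg.differentiable two_ne_zero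
  have hg1 : ContDiff ℝ 1 g := hg.of_le (by norm_num)
  have hdgc : ∀ i, Continuous (partialP i g) := fun i =>
    (contDiff_partialP hg (m := 1) (by norm_num) i).continuous
  have hχ1 : ContDiff ℝ 1 χ♭ := contDiff_cutoff_nat ω₂ lam β γ L n 1
  have hχd : Differentiable ℝ χ♭ := hχ1.differentiable one_ne_zero
  have hχc : HasCompactSupport χ♭ := hasCompactSupport_cutoff hω hl hβ γ L n
  have hχcont : Continuous χ♭ := hχ1.continuous
  have hχ01 : ∀ x, 0 ≤ χ♮ x ∧ χ♮ x ≤ 1 := fun x => cutoff_mem_Icc ω₂ lam β γ L n x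
  have hdχc : ∀ i, Continuous (partialP i χ♭) := fun i => continuous_partialP hχ1 one_ne_zero i
  have hχ2c : HasCompactSupport fun y : PhaseSpace L => χ♮ y ^ 2 :=
    hχc.comp_left (g := fun t : ℝ => t ^ 2) (by simp)
  -- the test function `v = g χ²`
  have hv1 : ContDiff ℝ 1 fun y : PhaseSpace L => g y * χ♮ y ^ 2 := hg1.mul (hχ1.pow 2)
  have hvc : HasCompactSupport fun y : PhaseSpace L => g y * χ♮ y ^ 2 := hχ2c.mul_left
  have hvcont : Continuous fun y : PhaseSpace L => g y * χ♮ y ^ 2 := hv1.continuous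
  have hχ2d : Differentiable ℝ fun y : PhaseSpace L => χ♮ y ^ 2 := hχd.pow 2
  have hdv : ∀ i x, partialP i (fun y : PhaseSpace L => g y * χ♮ y ^ 2) x =
      χ♮ x ^ 2 * partialP i g x + g x * (2 * χ♮ x * partialP i χ♭ x) := by
    intro i x
    rw [partialP_mul (g := fun y : PhaseSpace L => χ♮ y ^ 2) hgd hχ2d,
      partialP_comp (φ := fun t : ℝ => t ^ 2) (f := χ♭) (differentiable_pow 2) hχd]
    simp only [deriv_pow_field, Nat.cast_ofNat]
    ring
  -- Green for each thermostat, Liouville for the transport part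
  have hGreen : ∀ i, ∫ x, OU⟦T ; i ; g ; x⟧ * (g x * χ♮ x ^ 2) * ρ♭ x =
      -T * ∫ x, partialP i g x * partialP i (fun y : PhaseSpace L => g y * χ♮ y ^ 2) x * ρ♭ x :=
    fun i => integral_ou_mul_eq hU hV hT.ne' hg hv1 hvc i
  have hLiou : ∫ x, XH⟦Pch ; g ; x⟧ * (g x * χ♮ x ^ 2) * ρ♭ x = 0 :=
    integral_liouville_mul_self_cutoff_sq ω₂ lam β γ L T n hω hl hβ hg
  have hOUc : ∀ i, Continuous fun x : PhaseSpace L => OU⟦T ; i ; g ; x⟧ := fun i => continuous_ou T hg i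
  have hXHc : Continuous fun x : PhaseSpace L => XH⟦Pch ; g ; x⟧ := continuous_liouville hU hV hg1
  -- the integrals `A_i = ∫ (∂_i g)² χ² ρ` and `B_i = ∫ ∂_i g · g · χ · ∂_iχ ρ`
  have hA : ∀ i, Integrable fun x => partialP i g x ^ 2 * χ♮ x ^ 2 * ρ♭ x := fun i =>
    ((((hdgc i).pow 2).mul (hχcont.pow 2)).mul hρc).integrable_of_hasCompactSupport
      (hχ2c.mul_left.mul_right)
  have hBi : ∀ i, Integrable fun x => partialP i g x * g x * χ♮ x * partialP i χ♭ x * ρ♭ x := fun i =>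
    (((((hdgc i).mul hg.continuous).mul hχcont).mul (hdχc i)).mul hρc).integrable_of_hasCompactSupport
      (hχc.mul_left.mul_right.mul_right)
  have hA0 : ∀ i, 0 ≤ ∫ x, partialP i g x ^ 2 * χ♮ x ^ 2 * ρ♭ x := fun i =>
    integral_nonneg fun x => by have := hρ0 x; positivity
  -- `∫ 𝓛g · v ρ = ∑ c_i ∫ S_i g · v ρ`
  have hsplit : ∫ x, GEN⟦Pch ; T ; c ; g ; x⟧ * (g x * χ♮ x ^ 2) * ρ♭ x =
      ∑ i, c i * ∫ x, OU⟦T ; i ; g ; x⟧ * (g x * χ♮ x ^ 2) * ρ♭ x := by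
    have hint : ∀ i, Integrable fun x : PhaseSpace L =>
        c i * (OU⟦T ; i ; g ; x⟧ * (g x * χ♮ x ^ 2) * ρ♭ x) := fun i =>
      ((((hOUc i).mul hvcont).mul hρc).integrable_of_hasCompactSupport
        (hvc.mul_left.mul_right)).const_mul (c i)
    have e : (fun x : PhaseSpace L => GEN⟦Pch ; T ; c ; g ; x⟧ * (g x * χ♮ x ^ 2) * ρ♭ x) =
        fun x => XH⟦Pch ; g ; x⟧ * (g x * χ♮ x ^ 2) * ρ♭ x +
          ∑ i, c i * (OU⟦T ; i ; g ; x⟧ * (g x * χ♮ x ^ 2) * ρ♭ x) := by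
      funext x
      simp only [add_mul, Finset.sum_mul]
      exact congrArg _ (Finset.sum_congr rfl fun i _ => by ring)
    have hXv : Integrable fun x : PhaseSpace L => XH⟦Pch ; g ; x⟧ * (g x * χ♮ x ^ 2) * ρ♭ x :=
      ((hXHc.mul hvcont).mul hρc).integrable_of_hasCompactSupport (hvc.mul_left.mul_right)
    have hSv : Integrable fun x : PhaseSpace L =>
        ∑ i, c i * (OU⟦T ; i ; g ; x⟧ * (g x * χ♮ x ^ 2) * ρ♭ x) :=
      integrable_finsetSum _ fun i _ => hint i
    rw [e, integral_add hXv hSv, hLiou, zero_add, integral_finsetSum _ fun i _ => hint i]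
    exact Finset.sum_congr rfl fun i _ => integral_const_mul _ _
  -- `∫ ∂g ∂v ρ = A_i + 2 B_i`
  have hAB : ∀ i, ∫ x, partialP i g x * partialP i (fun y : PhaseSpace L => g y * χ♮ y ^ 2) x * ρ♭ x =
      (∫ x, partialP i g x ^ 2 * χ♮ x ^ 2 * ρ♭ x) +
        2 * ∫ x, partialP i g x * g x * χ♮ x * partialP i χ♭ x * ρ♭ x := by
    intro i
    rw [← integral_const_mul, ← integral_add (hA i) ((hBi i).const_mul 2)]
    congr 1
    funext x
    rw [hdv]
    ring
  -- bound on each `-2 B_i`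
  have hBbound : ∀ i, -2 * ∫ x, partialP i g x * g x * χ♮ x * partialP i χ♭ x * ρ♭ x ≤
      (1 / 2) * (∫ x, partialP i g x ^ 2 * χ♮ x ^ 2 * ρ♭ x) + 2 * C ^ 2 * ∫ x, g x ^ 2 * ρ♭ x := by
    intro i
    rw [← integral_const_mul, ← integral_const_mul, ← integral_const_mul,
      ← integral_add ((hA i).const_mul _) (hI2.const_mul _)]
    refine integral_mono ((hBi i).const_mul _) (((hA i).const_mul _).add (hI2.const_mul _))
      fun x => ?_
    have hρx := hρ0 x
    have h1 := hC i x
    have hC0 : 0 ≤ C := (abs_nonneg _).trans h1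
    -- `-2ab ≤ a²/2 + 2b²` with `a = ∂g χ`, `b = g ∂χ`, `|∂χ| ≤ C`
    have key : -2 * (partialP i g x * g x * χ♮ x * partialP i χ♭ x) ≤
        (1 / 2) * (partialP i g x ^ 2 * χ♮ x ^ 2) + 2 * (g x ^ 2 * partialP i χ♭ x ^ 2) := by
      nlinarith [sq_nonneg (partialP i g x * χ♮ x + 2 * (g x * partialP i χ♭ x))]
    have key2 : g x ^ 2 * partialP i χ♭ x ^ 2 ≤ C ^ 2 * g x ^ 2 := by
      have : partialP i χ♭ x ^ 2 ≤ C ^ 2 := by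
        rw [← sq_abs]; exact pow_le_pow_left₀ (abs_nonneg _) h1 2
      nlinarith [sq_nonneg (g x)]
    have e1 := mul_le_mul_of_nonneg_right key hρx.le
    have e2 := mul_le_mul_of_nonneg_right key2 hρx.le
    linarith [e1, e2]
  -- bound on `-∫ 𝓛g · v ρ`
  have hGbound : -(∫ x, GEN⟦Pch ; T ; c ; g ; x⟧ * (g x * χ♮ x ^ 2) * ρ♭ x) ≤
      ∫ x, |GEN⟦Pch ; T ; c ; g ; x⟧ * g x| * ρ♭ x := by
    rw [← integral_neg]
    have hint : Integrable fun x : PhaseSpace L => GEN⟦Pch ; T ; c ; g ; x⟧ * (g x * χ♮ x ^ 2) * ρ♭ x :=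
      (((hXHc.add (continuous_finsetSum _ fun i _ => continuous_const.mul (hOUc i))).mul
        hvcont).mul hρc).integrable_of_hasCompactSupport (hvc.mul_left.mul_right)
    refine integral_mono hint.neg hI1 fun x => ?_
    have hρx := hρ0 x
    have h01 := hχ01 x
    have hχ2 : χ♮ x ^ 2 ≤ 1 := by nlinarith [h01.1, h01.2]
    have : -(GEN⟦Pch ; T ; c ; g ; x⟧ * (g x * χ♮ x ^ 2)) ≤ |GEN⟦Pch ; T ; c ; g ; x⟧ * g x| := by
      have ha := neg_abs_le (GEN⟦Pch ; T ; c ; g ; x⟧ * g x)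
      have hb := le_abs_self (GEN⟦Pch ; T ; c ; g ; x⟧ * g x)
      have hx2 : 0 ≤ χ♮ x ^ 2 := sq_nonneg _
      nlinarith [mul_nonneg (abs_nonneg (GEN⟦Pch ; T ; c ; g ; x⟧ * g x)) hx2]
    simpa [neg_mul] using mul_le_mul_of_nonneg_right this hρx.le
  -- ### assembling: `T ∑ c_i A_i = -∫𝓛g v ρ - 2T ∑ c_i B_i ≤ ...`
  have hId : T * ∑ i, c i * ∫ x, partialP i g x ^ 2 * χ♮ x ^ 2 * ρ♭ x =
      -(∫ x, GEN⟦Pch ; T ; c ; g ; x⟧ * (g x * χ♮ x ^ 2) * ρ♭ x) +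
        T * ∑ i, c i * (-2 * ∫ x, partialP i g x * g x * χ♮ x * partialP i χ♭ x * ρ♭ x) := by
    rw [hsplit, Finset.mul_sum, Finset.mul_sum, ← Finset.sum_neg_distrib, ← Finset.sum_add_distrib]
    refine Finset.sum_congr rfl fun i _ => ?_
    rw [hGreen i, hAB i]
    ring
  have hsum_le : T * ∑ i, c i * (-2 * ∫ x, partialP i g x * g x * χ♮ x * partialP i χ♭ x * ρ♭ x) ≤
      T * ∑ i, c i * ((1 / 2) * (∫ x, partialP i g x ^ 2 * χ♮ x ^ 2 * ρ♭ x) +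
        2 * C ^ 2 * ∫ x, g x ^ 2 * ρ♭ x) := by
    refine mul_le_mul_of_nonneg_left (Finset.sum_le_sum fun i _ => ?_) hT.le
    exact mul_le_mul_of_nonneg_left (hBbound i) (hc i)
  have hrhs : T * ∑ i, c i * ((1 / 2) * (∫ x, partialP i g x ^ 2 * χ♮ x ^ 2 * ρ♭ x) +
        2 * C ^ 2 * ∫ x, g x ^ 2 * ρ♭ x) =
      T / 2 * ∑ i, c i * (∫ x, partialP i g x ^ 2 * χ♮ x ^ 2 * ρ♭ x) +
        2 * T * C ^ 2 * (∑ i, c i) * ∫ x, g x ^ 2 * ρ♭ x := by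
    simp only [Finset.mul_sum, Finset.sum_mul]
    rw [← Finset.sum_add_distrib]
    exact Finset.sum_congr rfl fun i _ => by ring
  linarith [hId, hsum_le, hrhs, hGbound]

/-- **Energy estimate.** For the pinned chain at `T > 0`, thermostat weights `c ≥ 0`, and
`g ∈ C²` with `g, 𝓛g ∈ L²(μ_T)` (`𝓛 = X_H + ∑ c_i S_i`): `∂_{p_i} g ∈ L²(μ_T)` for every site with
`c_i > 0` (the cut-off energy inequality and Fatou). [folklore] -/
theorem pinnedChain_memLp_partialP_of_gen (hω : 0 < ω₂) (hl : 0 ≤ lam) (hβ : 0 ≤ β) (γ : ℝ)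
    (L : ℕ) {T : ℝ} (hT : 0 < T) {c : Fin L → ℝ} (hc : ∀ i, 0 ≤ c i) {g : PhaseSpace L → ℝ}
    (hg : ContDiff ℝ 2 g) (hgL2 : MemLp g 2 ((Pch).gibbsMeasure L T))
    (hGL2 : MemLp (fun x : PhaseSpace L => GEN⟦Pch ; T ; c ; g ; x⟧) 2 ((Pch).gibbsMeasure L T))
    {i₀ : Fin L} (hi₀ : 0 < c i₀) :
    MemLp (partialP i₀ g) 2 ((Pch).gibbsMeasure L T) := by
  have hρc : Continuous ρ♭ := pinnedChain_continuous_gibbsDensity ω₂ lam β γ L T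
  have hρ0 : ∀ x, 0 < ρ♭ x := fun x => (Pch).gibbsDensity_pos L T x
  have hdgc : Continuous (partialP i₀ g) := (contDiff_partialP hg (m := 1) (by norm_num) i₀).continuous
  obtain ⟨C, hC0, hC⟩ := exists_cutoff_bounds hω.le hl hβ γ L T
  have hI1 : Integrable fun x : PhaseSpace L => |GEN⟦Pch ; T ; c ; g ; x⟧ * g x| * ρ♭ x := by
    have h := (hGL2.integrable_mul hgL2)
    rw [← pinnedChain_integrable_mul_gibbsDensity_iff hω hl hβ γ L hT] at h
    refine h.abs.congr (ae_of_all _ fun x => ?_)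
    simp only [Pi.mul_apply, abs_mul, abs_of_pos (hρ0 x)]
  have hI2 : Integrable fun x : PhaseSpace L => g x ^ 2 * ρ♭ x := by
    have h := hgL2.integrable_sq
    rwa [← pinnedChain_integrable_mul_gibbsDensity_iff hω hl hβ γ L hT] at h
  obtain ⟨B, hB⟩ : ∃ B : ℝ, B = (∫ x, |GEN⟦Pch ; T ; c ; g ; x⟧ * g x| * ρ♭ x) +
      2 * T * C ^ 2 * (∑ i, c i) * ∫ x, g x ^ 2 * ρ♭ x := ⟨_, rfl⟩
  -- Step 1: for every `n`, `∫ (∂g)² χ_n² ρ ≤ 2B/(T c_{i₀})`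
  have step1 : ∀ n : ℕ, ∫ x, partialP i₀ g x ^ 2 * χ♮ x ^ 2 * ρ♭ x ≤ 2 * B / (T * c i₀) := by
    intro n
    have hCn : ∀ (i : Fin L) (x : PhaseSpace L), |partialP i χ♭ x| ≤ C := by
      intro i x
      refine ((hC n i x).1).trans (div_le_self hC0 ?_)
      rw [Real.le_sqrt (by norm_num) (by positivity)]; simp
    have h := pinnedChain_energy_cutoff_le hω hl hβ γ L hT hc hg n hCn hI1 hI2
    rw [← hB] at h
    have hA0 : ∀ i, 0 ≤ c i * ∫ x, partialP i g x ^ 2 * χ♮ x ^ 2 * ρ♭ x := fun i =>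
      mul_nonneg (hc i) (integral_nonneg fun x => by have := hρ0 x; positivity)
    have hsingle : c i₀ * ∫ x, partialP i₀ g x ^ 2 * χ♮ x ^ 2 * ρ♭ x ≤
        ∑ i, c i * ∫ x, partialP i g x ^ 2 * χ♮ x ^ 2 * ρ♭ x :=
      Finset.single_le_sum (f := fun i => c i * ∫ x, partialP i g x ^ 2 * χ♮ x ^ 2 * ρ♭ x)
        (fun i _ => hA0 i) (Finset.mem_univ i₀)
    rw [le_div_iff₀ (mul_pos hT hi₀)]
    nlinarith [h, hsingle, hT, hi₀]
  -- Step 2: Fatou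
  obtain ⟨F, hF⟩ : ∃ F : PhaseSpace L → ℝ, ∀ x, F x = partialP i₀ g x ^ 2 * ρ♭ x :=
    ⟨fun x => partialP i₀ g x ^ 2 * ρ♭ x, fun x => rfl⟩
  have hF0 : ∀ x, 0 ≤ F x := fun x => by rw [hF]; have := hρ0 x; positivity
  have hFc : Continuous F := by
    have : F = fun x => partialP i₀ g x ^ 2 * ρ♭ x := funext hF
    rw [this]
    exact (hdgc.pow 2).mul hρc
  have hFn_int : ∀ n : ℕ, Integrable fun x => F x * χ♮ x ^ 2 := by
    intro n
    have h1 : Continuous fun x : PhaseSpace L => χ♮ x ^ 2 :=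
      (contDiff_cutoff_nat ω₂ lam β γ L n 1).continuous.pow 2
    have h2 : HasCompactSupport fun x : PhaseSpace L => χ♮ x ^ 2 :=
      (hasCompactSupport_cutoff hω hl hβ γ L n).comp_left (g := fun t : ℝ => t ^ 2) (by simp)
    have h3 : Continuous fun x : PhaseSpace L => F x * χ♮ x ^ 2 := hFc.mul h1
    exact h3.integrable_of_hasCompactSupport h2.mul_left
  have hlint : ∀ n : ℕ, ∫⁻ x, ENNReal.ofReal (F x * χ♮ x ^ 2) ≤ ENNReal.ofReal (2 * B / (T * c i₀)) := by
    intro n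
    rw [← ofReal_integral_eq_lintegral_ofReal (hFn_int n)
      (ae_of_all _ fun x => mul_nonneg (hF0 x) (sq_nonneg _))]
    refine ENNReal.ofReal_le_ofReal ?_
    have e : ∫ x, F x * χ♮ x ^ 2 = ∫ x, partialP i₀ g x ^ 2 * χ♮ x ^ 2 * ρ♭ x :=
      integral_congr_ae (ae_of_all _ fun x => by simp only [hF]; ring)
    rw [e]
    exact step1 n
  have hliminf : ∀ x, liminf (fun n : ℕ => ENNReal.ofReal (F x * χ♮ x ^ 2)) atTop =
      ENNReal.ofReal (F x) := by
    intro x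
    refine Tendsto.liminf_eq ?_
    refine (ENNReal.continuous_ofReal.tendsto _).comp ?_
    have := (tendsto_cutoff ω₂ lam β γ L x).pow 2
    simpa using this.const_mul (F x)
  have hfin : ∫⁻ x, ENNReal.ofReal (F x) < ⊤ := by
    have hmeas : ∀ n : ℕ, AEMeasurable (fun x => ENNReal.ofReal (F x * χ♮ x ^ 2)) volume := fun n =>
      (hFn_int n).aestronglyMeasurable.aemeasurable.ennreal_ofReal
    calc ∫⁻ x, ENNReal.ofReal (F x)
        = ∫⁻ x, liminf (fun n : ℕ => ENNReal.ofReal (F x * χ♮ x ^ 2)) atTop := by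
          simp only [hliminf]
      _ ≤ liminf (fun n : ℕ => ∫⁻ x, ENNReal.ofReal (F x * χ♮ x ^ 2)) atTop :=
          lintegral_liminf_le' hmeas
      _ ≤ ENNReal.ofReal (2 * B / (T * c i₀)) := by
          refine (liminf_le_liminf (Eventually.of_forall hlint)).trans ?_
          rw [liminf_const]
      _ < ⊤ := ENNReal.ofReal_lt_top
  have hFint : Integrable F := by
    refine ⟨hFc.aestronglyMeasurable, ?_⟩
    rw [hasFiniteIntegral_iff_ofReal (ae_of_all _ hF0)]
    exact hfin
  have hsq : Integrable (fun x => partialP i₀ g x ^ 2) ((Pch).gibbsMeasure L T) := by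
    rw [← pinnedChain_integrable_mul_gibbsDensity_iff hω hl hβ γ L hT]
    exact hFint.congr (ae_of_all _ fun x => hF x)
  exact (memLp_two_iff_integrable_sq hdgc.aestronglyMeasurable).mpr hsq

end Energy

/-- Registered helper stub of this support file: the energy estimate (`∂_{p_i} g ∈ L²(μ_T)` on the weighted sites). [folklore] -/
theorem helper_insertionEnergy : ∀ {ω₂ lam β : ℝ}, 0 < ω₂ → 0 ≤ lam → 0 ≤ β → ∀ (γ : ℝ) (L : ℕ) {T : ℝ}, 0 < T → ∀ {c : Fin L → ℝ}, (∀ i, 0 ≤ c i) → ∀ {g : PhaseSpace L → ℝ}, ContDiff ℝ 2 g → MemLp g 2 ((pinnedChain ω₂ lam β γ).gibbsMeasure L T) → MemLp (fun x : PhaseSpace L => (∑ i, (x.2 i * partialQ i g x - partialQ i ((pinnedChain ω₂ lam β γ).hamiltonian L) x * partialP i g x)) + ∑ i, c i * (T * partialP i (partialP i g) x - x.2 i * partialP i g x)) 2 ((pinnedChain ω₂ lam β γ).gibbsMeasure L T) → ∀ {i₀ : Fin L}, 0 < c i₀ → MemLp (partialP i₀ g) 2 ((pinnedChain ω₂ lam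 β γ).gibbsMeasure L T) := by
  intro ω₂ lam β hω hl hβ γ L T hT c hc g hg hgL2 hGL2 i₀ hi₀
  exact pinnedChain_memLp_partialP_of_gen hω hl hβ γ L hT hc hg hgL2 hGL2 hi₀

end Summit.AtomisticToContinuum.FouriersLaw.Cruxes.SuperadditiveResistance.InsertionToolbox

end
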